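import Summits.CriticalPhenomena.SAWScalingLimit.Theses.SAWDefectDecoherence
import Summits.CriticalPhenomena.SAWScalingLimit.Theorems.MassRatio.Negative.Tools
import Literature.Analysis.FunctionSpaces.SequentialWeakStarExtraction
import HarnessLib

/-!
# Weak-* subsequential limits of the normalised bulk functionals (crux `BoundaryClosureR`,
stmt-CriticalPhenomena-14004, line `pick-half-plane`, engine input S1; registered sub-goal
`pickEngine_weakStarLimit`)

For a FIXED family of domains `Λ δ`, roots `e δ`, normalisers `b δ` and an open `U ⊆ ℂ`, write
`F_δ = F(e δ, ·, x_c, 5/8)` and `N_δ(ψ) := δ² (Σ_{z ∈ Ω_δ} ψ(δ·mid z) F_δ(z)) / F_δ(b δ)` (the body of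
the skeleton's `NF`).  THEOREM (`weakStarLimit_of_localL1`): if the local `L¹` law holds on every
compact `K ⊆ U` (the conclusion of the stub `LocalL1Bound` for this family), then every mesh sequence
`ns → 0⁺` has a subsequence `ns ∘ ms` along which `N_{ns (ms n)}(ψ) → L ψ` for EVERY continuous
compactly supported `ψ` with `tsupport ψ ⊆ U`; the limit `L` is linear on these test functions,
satisfies `‖L ψ‖ ≤ C_K · sup ‖ψ‖` for `tsupport ψ ⊆ K`, and on every compact `K ⊆ U` it is represented
by a continuous linear functional on `ℂ →ᵇ ℂ` (`Λb f = L f` whenever `tsupport f ⊆ K`) — the input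
format of Weyl's lemma `Literature.Analysis.Complex.weyl_dbar_ball_functional`.

Proof (the lattice/bookkeeping half of S1): a compact exhaustion `K_m` of `U`
(`exists_compact_exhaustion`, from Mathlib's `CompactExhaustion` of the subtype); at mesh `ns n` the
functional `ψ ↦ N(ψ)` restricted to `C(K_m, ℂ)` is a FINITE sum of evaluations
(`exists_evalFunctional`), of norm `≤ C'_m := max C_{K_m} 0` as soon as the `L¹` event at `ns n`
holds (it holds eventually; before, the functional is replaced by `0`, which does not affect
limits); the spaces `C(K_m, ℂ)` are separable Banach, so ONE diagonal subsequence makes all of them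
converge weak-* (`Literature.Analysis.FunctionSpaces.exists_strictMono_weakStar_tendsto`, sequential
Banach–Alaoglu); the limits on different `K_m` are glued by uniqueness of limits (`L ψ := lim`), and
restriction `ℂ →ᵇ ℂ → C(K_m, ℂ)` (`exists_restrictCLM`) gives the representing functionals.
-/

noncomputable section

open scoped BigOperators Topology BoundedContinuousFunction Classical
open Filter Set
open Literature.Probability.LatticeModels Literature.Probability.RandomPlanarGeometry
open Literature.Probability.RandomPlanarGeometry.SAW
open Summit.CriticalPhenomena.SAWScalingLimit.Theorems.MassRatio.Negative (hexDomainMidEdges_finite)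

namespace Summit.CriticalPhenomena.SAWScalingLimit.Theorems.PickHalfPlane.LocalL1

/-! ### Helpers: exhaustion, evaluation functionals, restriction -/

/-- **Compact exhaustion of an open subset of `ℂ`** adapted to compacts: compact sets `K m ⊆ U`
such that every compact subset of `U` lies in some `K m`. -/
theorem exists_compact_exhaustion {U : Set ℂ} (hU : IsOpen U) :
    ∃ K : ℕ → Set ℂ, (∀ m, IsCompact (K m)) ∧ (∀ m, K m ⊆ U) ∧
      ∀ L : Set ℂ, IsCompact L → L ⊆ U → ∃ m, L ⊆ K m := by
  haveI : LocallyCompactSpace U := hU.locallyCompactSpace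
  set KX := CompactExhaustion.choice U
  refine ⟨fun m => ((↑) : U → ℂ) '' (KX m), fun m => (KX.isCompact m).image continuous_subtype_val,
    fun m => Subtype.coe_image_subset _ _, fun L hL hLU => ?_⟩
  have hL' : IsCompact (((↑) : U → ℂ) ⁻¹' L) := by
    rw [Topology.IsEmbedding.subtypeVal.isCompact_iff]
    rwa [Set.image_preimage_eq_inter_range, Subtype.range_coe, Set.inter_eq_left.2 hLU]
  obtain ⟨m, hm⟩ := KX.exists_superset_of_isCompact hL'
  refine ⟨m, fun z hz => ⟨⟨z, hLU hz⟩, hm hz, rfl⟩⟩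

/-- **Finite sums of evaluations as a bounded functional on `C(K, ℂ)`.**  For points `p z` and
coefficients `a z` (`z ∈ S`) with `Σ_{z ∈ S, p z ∈ K} ‖a z‖ ≤ C`, the functional
`f ↦ Σ_{z ∈ S} a z · f(p z)` (terms with `p z ∉ K` read as `0`) is continuous linear of norm `≤ C`. -/
theorem exists_evalFunctional {ι : Type*} (K : Set ℂ) [CompactSpace K] (S : Finset ι)
    (p : ι → ℂ) (a : ι → ℂ) {C : ℝ} (ha : ∑ z ∈ S.filter (fun z => p z ∈ K), ‖a z‖ ≤ C) :
    ∃ T : C(K, ℂ) →L[ℂ] ℂ, (∀ f, ‖T f‖ ≤ C * ‖f‖) ∧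
      ∀ f, T f = ∑ z ∈ S, a z * (if h : p z ∈ K then f ⟨p z, h⟩ else 0) := by
  classical
  let Tl : C(K, ℂ) →ₗ[ℂ] ℂ :=
    { toFun := fun f => ∑ z ∈ S, a z * (if h : p z ∈ K then f ⟨p z, h⟩ else 0)
      map_add' := fun f g => by
        rw [← Finset.sum_add_distrib]
        refine Finset.sum_congr rfl fun z _ => ?_
        split_ifs <;> simp [mul_add]
      map_smul' := fun c f => by
        rw [RingHom.id_apply, smul_eq_mul, Finset.mul_sum]
        refine Finset.sum_congr rfl fun z _ => ?_
        split_ifs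
        · simp only [ContinuousMap.smul_apply, smul_eq_mul]; ring
        · simp }
  have hbound : ∀ f : C(K, ℂ), ‖Tl f‖ ≤ C * ‖f‖ := by
    intro f
    have hterm : ∀ z ∈ S, ‖a z * (if h : p z ∈ K then f ⟨p z, h⟩ else 0)‖ ≤
        (if p z ∈ K then ‖a z‖ else 0) * ‖f‖ := by
      intro z _
      by_cases h : p z ∈ K
      · rw [dif_pos h, if_pos h, norm_mul]
        exact mul_le_mul_of_nonneg_left (f.norm_coe_le_norm _) (norm_nonneg _)
      · rw [dif_neg h, if_neg h]; simp
    calc ‖Tl f‖ ≤ ∑ z ∈ S, ‖a z * (if h : p z ∈ K then f ⟨p z, h⟩ else 0)‖ := norm_sum_le _ _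
      _ ≤ ∑ z ∈ S, (if p z ∈ K then ‖a z‖ else 0) * ‖f‖ := Finset.sum_le_sum hterm
      _ = (∑ z ∈ S.filter (fun z => p z ∈ K), ‖a z‖) * ‖f‖ := by
          rw [← Finset.sum_mul, Finset.sum_filter]
      _ ≤ C * ‖f‖ := mul_le_mul_of_nonneg_right ha (norm_nonneg _)
  exact ⟨Tl.mkContinuous C hbound, fun f => by rw [Tl.mkContinuous_apply]; exact hbound f,
    fun f => rfl⟩

/-- Restriction of bounded continuous functions on `ℂ` to a compact set, as a continuous linear
map into `C(K, ℂ)` (norm `≤ 1`). -/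
theorem exists_restrictCLM (K : Set ℂ) [CompactSpace K] :
    ∃ R : (ℂ →ᵇ ℂ) →L[ℂ] C(K, ℂ), ∀ f : ℂ →ᵇ ℂ, R f = f.toContinuousMap.restrict K := by
  let Rl : (ℂ →ᵇ ℂ) →ₗ[ℂ] C(K, ℂ) :=
    { toFun := fun f => f.toContinuousMap.restrict K
      map_add' := fun f g => by ext; rfl
      map_smul' := fun c f => by ext; rfl }
  refine ⟨Rl.mkContinuous 1 fun f => ?_, fun f => rfl⟩
  rw [one_mul]
  exact (ContinuousMap.norm_le _ (norm_nonneg f)).2 fun x => f.norm_coe_le_norm x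

/-! ### The weak-* subsequential limit of the normalised functionals -/

/-- **Weak-* subsequential limits of the normalised bulk functionals from the local `L¹` law.**
Fix a family of domains `Λ δ`, roots `e δ`, normalisers `b δ`, an open `U ⊆ ℂ`, and write
`N_δ(ψ) = δ² (Σ_{z ∈ Ω_δ} ψ(δ·mid z) F_δ(z)) / F_δ(b δ)` (`F_δ = F(e δ, ·, x_c, 5/8)`).  If the local
`L¹` law holds on every compact `K ⊆ U` (`δ² Σ_{δ·mid z ∈ K} ‖F_δ(z)‖ ≤ C_K ‖F_δ(b δ)‖` eventually),
then every mesh sequence `ns → 0⁺` has a subsequence `ns ∘ ms` along which `N` converges on EVERY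
continuous compactly supported `ψ` with `tsupport ψ ⊆ U` to a limit `L ψ`; `L` is linear on these
test functions, `‖L ψ‖ ≤ C_K ‖ψ‖_∞` for `tsupport ψ ⊆ K`, and on every compact `K ⊆ U` it is
represented by a continuous linear functional on `ℂ →ᵇ ℂ` (the form Weyl's lemma consumes).
Proof: package `N_{ns n}` restricted to a compact exhaustion `K_m` of `U` as uniformly bounded
functionals on the separable Banach spaces `C(K_m, ℂ)` (finite sums of evaluations), extract one
diagonal subsequence by sequential Banach–Alaoglu
(`Literature.Analysis.FunctionSpaces.exists_strictMono_weakStar_tendsto`), and glue by uniqueness of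
limits. -/
theorem weakStarLimit_of_localL1 (Λ : ℝ → Finset HexVertex) (e b : ℝ → Sym2 HexVertex)
    {U : Set ℂ} (hU : IsOpen U)
    (hL1 : ∀ K : Set ℂ, IsCompact K → K ⊆ U → ∃ C : ℝ, ∀ᶠ δ : ℝ in 𝓝[>] 0,
      δ ^ 2 * (∑ᶠ z ∈ {z : Sym2 HexVertex | z ∈ hexDomainMidEdges (Λ δ) ∧
          (δ : ℂ) * hexMidpoint z ∈ K},
        ‖hexParafermionicObservable (Λ δ) (e δ) hexCriticalFugacity (5 / 8) z‖) ≤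
        C * ‖hexParafermionicObservable (Λ δ) (e δ) hexCriticalFugacity (5 / 8) (b δ)‖)
    (ns : ℕ → ℝ) (hns : Tendsto ns atTop (𝓝[>] 0)) :
    ∃ ms : ℕ → ℕ, StrictMono ms ∧ ∃ L : C(ℂ, ℂ) → ℂ,
      (∀ ψ : C(ℂ, ℂ), HasCompactSupport ψ → tsupport ψ ⊆ U →
        Tendsto (fun n => ((ns (ms n) : ℝ) : ℂ) ^ 2 *
          (∑ᶠ z ∈ hexDomainMidEdges (Λ (ns (ms n))),
            ψ (((ns (ms n) : ℝ) : ℂ) * hexMidpoint z) *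
              hexParafermionicObservable (Λ (ns (ms n))) (e (ns (ms n))) hexCriticalFugacity
                (5 / 8) z) /
          hexParafermionicObservable (Λ (ns (ms n))) (e (ns (ms n))) hexCriticalFugacity (5 / 8)
            (b (ns (ms n)))) atTop (𝓝 (L ψ))) ∧
      (∀ ψ₁ ψ₂ : C(ℂ, ℂ), HasCompactSupport ψ₁ → tsupport ψ₁ ⊆ U → HasCompactSupport ψ₂ →
        tsupport ψ₂ ⊆ U → L (ψ₁ + ψ₂) = L ψ₁ + L ψ₂) ∧
      (∀ (c : ℂ) (ψ : C(ℂ, ℂ)), HasCompactSupport ψ → tsupport ψ ⊆ U → L (c • ψ) = c * L ψ) ∧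
      (∀ K : Set ℂ, IsCompact K → K ⊆ U → ∃ C : ℝ, 0 ≤ C ∧ ∀ ψ : C(ℂ, ℂ), tsupport ψ ⊆ K →
        ∀ M : ℝ, (∀ z, ‖ψ z‖ ≤ M) → ‖L ψ‖ ≤ C * M) ∧
      (∀ K : Set ℂ, IsCompact K → K ⊆ U → ∃ Λb : (ℂ →ᵇ ℂ) →L[ℂ] ℂ,
        ∀ f : ℂ →ᵇ ℂ, tsupport f ⊆ K → Λb f = L f.toContinuousMap) := by
  classical
  ---------------------------------------------------------------- notation
  -- `Fδ n z`, the points `p n z`, the mid-edge finsets `S n`, and the functional `N n ψ`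
  obtain ⟨Fo, hFo⟩ : ∃ Fo : ℕ → Sym2 HexVertex → ℂ, Fo = fun n z =>
      hexParafermionicObservable (Λ (ns n)) (e (ns n)) hexCriticalFugacity (5 / 8) z := ⟨_, rfl⟩
  obtain ⟨p, hp⟩ : ∃ p : ℕ → Sym2 HexVertex → ℂ, p = fun n z =>
      ((ns n : ℝ) : ℂ) * hexMidpoint z := ⟨_, rfl⟩
  obtain ⟨S, hS⟩ : ∃ S : ℕ → Finset (Sym2 HexVertex), S = fun n =>
      (hexDomainMidEdges_finite (Λ (ns n))).toFinset := ⟨_, rfl⟩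
  obtain ⟨N, hN⟩ : ∃ N : ℕ → (ℂ → ℂ) → ℂ, N = fun n ψ => ((ns n : ℝ) : ℂ) ^ 2 *
      (∑ᶠ z ∈ hexDomainMidEdges (Λ (ns n)), ψ (p n z) * Fo n z) / Fo n (b (ns n)) := ⟨_, rfl⟩
  have hSmem : ∀ n z, z ∈ S n ↔ z ∈ hexDomainMidEdges (Λ (ns n)) := fun n z => by
    rw [hS, Set.Finite.mem_toFinset]
  -- `N n ψ` as a finite sum
  have hNsum : ∀ n (ψ : ℂ → ℂ), N n ψ =
      ∑ z ∈ S n, ((ns n : ℝ) : ℂ) ^ 2 * Fo n z / Fo n (b (ns n)) * ψ (p n z) := by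
    intro n ψ
    rw [hN]
    simp only
    rw [finsum_mem_eq_finite_toFinset_sum _ (hexDomainMidEdges_finite _), Finset.mul_sum,
      Finset.sum_div, hS]
    exact Finset.sum_congr rfl fun z _ => by ring
  have hNadd : ∀ n (ψ₁ ψ₂ : ℂ → ℂ), N n (ψ₁ + ψ₂) = N n ψ₁ + N n ψ₂ := by
    intro n ψ₁ ψ₂
    simp only [hNsum, Pi.add_apply, mul_add, Finset.sum_add_distrib]
  have hNsmul : ∀ n (c : ℂ) (ψ : ℂ → ℂ), N n (c • ψ) = c * N n ψ := by
    intro n c ψ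
    simp only [hNsum, Pi.smul_apply, smul_eq_mul, Finset.mul_sum]
    exact Finset.sum_congr rfl fun z _ => by ring
  ---------------------------------------------------------------- exhaustion and constants
  obtain ⟨K, hKc, hKU, hKex⟩ := exists_compact_exhaustion hU
  haveI hKcs : ∀ m, CompactSpace (K m) := fun m => isCompact_iff_compactSpace.1 (hKc m)
  choose C hC using fun m => hL1 (K m) (hKc m) (hKU m)
  obtain ⟨C', hC'⟩ : ∃ C' : ℕ → ℝ, C' = fun m => max (C m) 0 := ⟨_, rfl⟩
  have hC'0 : ∀ m, 0 ≤ C' m := fun m => by rw [hC']; exact le_max_right _ _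
  -- the `L¹` event at mesh `ns n` on `K m`
  obtain ⟨good, hgood⟩ : ∃ good : ℕ → ℕ → Prop, good = fun m n =>
      (ns n) ^ 2 * ∑ z ∈ (S n).filter (fun z => p n z ∈ K m), ‖Fo n z‖ ≤
        C' m * ‖Fo n (b (ns n))‖ := ⟨_, rfl⟩
  have hev : ∀ m, ∀ᶠ n in atTop, good m n := by
    intro m
    refine (hns.eventually (hC m)).mono fun n hn => ?_
    rw [hgood]
    have hset : {z : Sym2 HexVertex | z ∈ hexDomainMidEdges (Λ (ns n)) ∧
        ((ns n : ℝ) : ℂ) * hexMidpoint z ∈ K m} = ↑((S n).filter fun z => p n z ∈ K m) := by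
      ext z
      simp only [Set.mem_setOf_eq, Finset.coe_filter, hSmem, hp]
    rw [hset, finsum_mem_coe_finset] at hn
    have h1 : C m * ‖Fo n (b (ns n))‖ ≤ C' m * ‖Fo n (b (ns n))‖ :=
      mul_le_mul_of_nonneg_right (by rw [hC']; exact le_max_left _ _) (norm_nonneg _)
    have h2 : (ns n) ^ 2 * ∑ z ∈ (S n).filter (fun z => p n z ∈ K m), ‖Fo n z‖ ≤
        C m * ‖Fo n (b (ns n))‖ := by
      simpa only [hFo] using hn
    exact h2.trans h1
  ---------------------------------------------------------------- the functionals on `C(K m, ℂ)`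
  obtain ⟨a, ha⟩ : ∃ a : ℕ → ℕ → Sym2 HexVertex → ℂ, a = fun m n z =>
      if good m n then ((ns n : ℝ) : ℂ) ^ 2 * Fo n z / Fo n (b (ns n)) else 0 := ⟨_, rfl⟩
  have habound : ∀ m n, ∑ z ∈ (S n).filter (fun z => p n z ∈ K m), ‖a m n z‖ ≤ C' m := by
    intro m n
    rw [ha]
    by_cases hg : good m n
    · simp only [hg, if_true]
      by_cases hFb : Fo n (b (ns n)) = 0
      · simp only [hFb, div_zero, norm_zero, Finset.sum_const_zero]
        exact hC'0 m
      · have hFb' : 0 < ‖Fo n (b (ns n))‖ := norm_pos_iff.2 hFb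
        rw [hgood] at hg
        have hns0 : 0 ≤ ns n ^ 2 := sq_nonneg _
        have key : ∑ z ∈ (S n).filter (fun z => p n z ∈ K m),
            ‖((ns n : ℝ) : ℂ) ^ 2 * Fo n z / Fo n (b (ns n))‖ =
            ((ns n) ^ 2 * ∑ z ∈ (S n).filter (fun z => p n z ∈ K m), ‖Fo n z‖) /
              ‖Fo n (b (ns n))‖ := by
          rw [Finset.mul_sum, Finset.sum_div]
          refine Finset.sum_congr rfl fun z _ => ?_
          simp only [norm_div, norm_mul, norm_pow, Complex.norm_real, Real.norm_eq_abs, sq_abs]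
        rw [key, div_le_iff₀ hFb']
        exact hg
    · simp only [hg, if_false, norm_zero, Finset.sum_const_zero]
      exact hC'0 m
  choose T hTb hTapp using fun m n =>
    exists_evalFunctional (K m) (S n) (p n) (a m n) (habound m n)
  -- identification with `N` on test functions supported in `K m`, at good meshes
  have hident : ∀ m n (ψ : C(ℂ, ℂ)), tsupport ψ ⊆ K m → good m n →
      T m n (ψ.restrict (K m)) = N n ψ := by
    intro m n ψ hψ hg
    rw [hTapp, hNsum]
    refine Finset.sum_congr rfl fun z _ => ?_
    rw [ha]
    simp only [hg, if_true]
    congr 1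
    by_cases h : p n z ∈ K m
    · rw [dif_pos h, ContinuousMap.restrict_apply]
    · rw [dif_neg h]
      exact (image_eq_zero_of_notMem_tsupport fun h' => h (hψ h')).symm
  ---------------------------------------------------------------- extraction
  obtain ⟨φ, hφ, hlim⟩ :=
    Literature.Analysis.FunctionSpaces.exists_strictMono_weakStar_tendsto (𝕜 := ℂ)
      (fun m => C(K m, ℂ)) T C' hC'0 hTb
  choose Lm hLmb hLmt using hlim
  -- convergence of `N` along `φ` on test functions supported in `K m`
  have hconvK : ∀ m (ψ : C(ℂ, ℂ)), tsupport ψ ⊆ K m →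
      Tendsto (fun n => N (φ n) ψ) atTop (𝓝 (Lm m (ψ.restrict (K m)))) := by
    intro m ψ hψ
    refine (hLmt m (ψ.restrict (K m))).congr' ?_
    filter_upwards [hφ.tendsto_atTop.eventually (hev m)] with n hn
    exact hident m (φ n) ψ hψ hn
  ---------------------------------------------------------------- the limit functional
  refine ⟨φ, hφ, fun ψ => limUnder atTop (fun n => N (φ n) ψ), ?_, ?_, ?_, ?_, ?_⟩
  · -- convergence on all test functions
    intro ψ hψc hψU
    obtain ⟨m, hm⟩ := hKex (tsupport ψ) hψc hψU
    have h := tendsto_nhds_limUnder ⟨_, hconvK m ψ hm⟩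
    exact h.congr fun n => by simp only [hN, hFo, hp]
  · -- additivity
    intro ψ₁ ψ₂ h₁c h₁U h₂c h₂U
    obtain ⟨m₁, hm₁⟩ := hKex (tsupport ψ₁) h₁c h₁U
    obtain ⟨m₂, hm₂⟩ := hKex (tsupport ψ₂) h₂c h₂U
    have h₁ := tendsto_nhds_limUnder ⟨_, hconvK m₁ ψ₁ hm₁⟩
    have h₂ := tendsto_nhds_limUnder ⟨_, hconvK m₂ ψ₂ hm₂⟩
    have h12 : Tendsto (fun n => N (φ n) ⇑(ψ₁ + ψ₂)) atTop
        (𝓝 (limUnder atTop (fun n => N (φ n) ψ₁) + limUnder atTop (fun n => N (φ n) ψ₂))) := by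
      have := h₁.add h₂
      refine this.congr fun n => ?_
      rw [ContinuousMap.coe_add, hNadd]
    exact h12.limUnder_eq
  · -- homogeneity
    intro c ψ hψc hψU
    obtain ⟨m, hm⟩ := hKex (tsupport ψ) hψc hψU
    have h := tendsto_nhds_limUnder ⟨_, hconvK m ψ hm⟩
    have hc : Tendsto (fun n => N (φ n) ⇑(c • ψ)) atTop
        (𝓝 (c * limUnder atTop (fun n => N (φ n) ψ))) := by
      refine (h.const_mul c).congr fun n => ?_
      rw [ContinuousMap.coe_smul, hNsmul]
    exact hc.limUnder_eq
  · -- bound on compacts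
    intro K₀ hK₀ hK₀U
    obtain ⟨m, hm⟩ := hKex K₀ hK₀ hK₀U
    refine ⟨C' m, hC'0 m, fun ψ hψ M hM => ?_⟩
    have hM0 : 0 ≤ M := (norm_nonneg _).trans (hM 0)
    have hψm : tsupport ψ ⊆ K m := hψ.trans hm
    dsimp only
    rw [(hconvK m ψ hψm).limUnder_eq]
    refine (hLmb m _).trans (mul_le_mul_of_nonneg_left ?_ (hC'0 m))
    exact (ContinuousMap.norm_le _ hM0).2 fun x => by rw [ContinuousMap.restrict_apply]; exact hM x
  · -- representation on compacts by functionals on `ℂ →ᵇ ℂ`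
    intro K₀ hK₀ hK₀U
    obtain ⟨m, hm⟩ := hKex K₀ hK₀ hK₀U
    obtain ⟨R, hR⟩ := exists_restrictCLM (K m)
    refine ⟨(Lm m).comp R, fun f hf => ?_⟩
    have hfm : tsupport (f.toContinuousMap : ℂ → ℂ) ⊆ K m := hf.trans hm
    dsimp only
    rw [ContinuousLinearMap.comp_apply, hR, (hconvK m f.toContinuousMap hfm).limUnder_eq]

/-- **Registered sub-goal `pickEngine_weakStarLimit`** (crux item stmt-CriticalPhenomena-14004, line
`pick-half-plane`, engine input S1): weak-* subsequential limits of the normalised bulk functionals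
from the local `L¹` law alone, in registry form (one `∀`-term; see `weakStarLimit_of_localL1`). -/
theorem pickEngine_weakStarLimit : ∀ (Λ : ℝ → Finset HexVertex) (e b : ℝ → Sym2 HexVertex) (U : Set ℂ), IsOpen U → (∀ K : Set ℂ, IsCompact K → K ⊆ U → ∃ C : ℝ, ∀ᶠ δ : ℝ in 𝓝[>] 0, δ ^ 2 * (∑ᶠ z ∈ {z : Sym2 HexVertex | z ∈ hexDomainMidEdges (Λ δ) ∧ (δ : ℂ) * hexMidpoint z ∈ K}, ‖hexParafermionicObservable (Λ δ) (e δ) hexCriticalFugacity (5 / 8) z‖) ≤ C * ‖hexParafermionicObservable (Λ δ) (e δ) hexCriticalFugacity (5 / 8) (b δ)‖) → ∀ ns : ℕ → ℝ, Tendsto ns atTop (𝓝[>] 0) → ∃ ms : ℕ → ℕ, StrictMono ms ∧ ∃ L : C(ℂ, ℂ) → ℂ, (∀ ψ : C(ℂ, ℂ), HasCompactSupport ψ → tsupport ψ ⊆ U → Tendsto (fun n => ((ns (ms n) : ℝ) : ℂ) ^ 2 * (∑ᶠ z ∈ hexDomainMidEdges (Λ (ns (ms n))), ψ (((ns (ms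 n) : ℝ) : ℂ) * hexMidpoint z) * hexParafermionicObservable (Λ (ns (ms n))) (e (ns (ms n))) hexCriticalFugacity (5 / 8) z) / hexParafermionicObservable (Λ (ns (ms n))) (e (ns (ms n))) hexCriticalFugacity (5 / 8) (b (ns (ms n)))) atTop (𝓝 (L ψ))) ∧ (∀ ψ₁ ψ₂ : C(ℂ, ℂ), HasCompactSupport ψ₁ → tsupport ψ₁ ⊆ U → HasCompactSupport ψ₂ → tsupport ψ₂ ⊆ U → L (ψ₁ + ψ₂) = L ψ₁ + L ψ₂) ∧ (∀ (c : ℂ) (ψ : C(ℂ, ℂ)), HasCompactSupport ψ → tsupport ψ ⊆ U → L (c • ψ) = c * L ψ) ∧ (∀ K : Set ℂ, IsCompact K → K ⊆ U → ∃ C : ℝ, 0 ≤ C ∧ ∀ ψ : C(ℂ, ℂ), tsupport ψ ⊆ K → ∀ M : ℝ, (∀ z, ‖ψ z‖ ≤ M) → ‖L ψ‖ ≤ C * M) ∧ (∀ K : Set ℂ, IsCompact K → K ⊆ U → ∃ Λb : BoundedContinuousFunction ℂ ℂ →L[ℂ] ℂ, ∀ f : BoundedContinuousFunction ℂ ℂ,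 tsupport f ⊆ K → Λb f = L f.toContinuousMap) :=
  fun Λ e b _ hU hL1 ns hns => weakStarLimit_of_localL1 Λ e b hU hL1 ns hns

end Summit.CriticalPhenomena.SAWScalingLimit.Theorems.PickHalfPlane.LocalL1

end
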